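/-
Copyright (c) 2026 the pub-hodgecm-mathlib formalisation cell (harness21).  Prover seat hodgecm-mathlib-LD1-p02 (g0), organ payer of half-A
line LD1 (dealer LD1-plan (g0); 2026-09-02T03:42:40Z «LD1 takes the relative corollary»), 2026-09-02.
THEOREMS ONLY (no definition, no named fact, no `sorry`, no instance, no notation).  `--supports stmt-HodgeConjecture-24832 --as helper`.
-/
import Summits.HodgeConjecture.HodgeConjecture.Theorems.F0LD2ArchSignAt
import HarnessLib

/-!
# [Liu2021, Lem. D.2 (3)] at the place of `ι`, RELATIVE form for line LD1 (organ (L), step (L-Dι)): two holomorphic-cotangent `P`, `P′` of the CM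
# unitary curve (same `H`, same cone frame, same scaled frame and pinned transport) meeting the theta lifts from `⟨a′⟩`, `⟨a″⟩` have
# `Im e♮(a′δ′)`, `Im e♮(a″δ′)` OF THE SAME SIGN — no orientation of `t` needed beyond `Im ι(t) = 0`

Cell hodgecm-mathlib FLOOR 0, programme P6, half-A line LD (crux `hLiu418` = `stmt-HodgeConjecture-24832`); line LD1, organ (L) `ThetaLinePinned₂` of the leaf
`Cruxes/HLiu418/Lines/F0_P6LD_StubS1FactsThetaRoad.lean` (v7 e4119f23732f6444 :354), archimedean step (L-Dι) of LD1-plan (g0)'s ruling 2026-09-02T03:42:40Z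
(LD-ref1's orientation-free road (β)).  Namespace `Summit.HodgeConjecture.HodgeConjecture.Cruxes.HLiu418.F0LD1ArchSignRelative`.

* `im_mul_im_pos_of_meets_of_hol₂` — under organ (L)'s field ∕ frame ∕ signature ∕ definiteness ∕ degree binders plus `Im ι(t) = 0`: if `P` meets the theta lift
  from `⟨a′⟩` and `P′` the one from `⟨a″⟩` (same `λ`, same pinned `ιA`) and both are holomorphic-cotangent at `cmPlace L ι` for the same cone frame `𝔣`, then
  `0 < Im e♮(a′·(2·imagUnit L)⁻¹) · Im e♮(a″·(2·imagUnit L)⁻¹)` — both products with `Re e♮(t)` are negative by the TWO-SIDED ★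
  `F0LD2ArchSignAt.re_mul_im_lt_zero_of_meets_of_hol₂` (the frame signs are read off the signature hypothesis for EITHER sign of `Re ι(t)`).

HONEST SCOPE.  A corollary for organ (L)'s closer (helper, `--supports`); organ (L), the line and HC_CM are NOT proved here — HC_CM stays conditional on the
remaining printed inputs (hLiu418, h413) until rung 0 closes.  `Im ι(t) = 0` is automatic in the crux (there `H` and `t • H` are both `c`-hermitian, `H ≠ 0`),
but it is NOT among organ (L)'s v7 binders: the consumer supplies it.

## References
* [Liu2021] Y. Liu, arXiv:2102.11518, App. D Lem. D.2 (3) (p. 127 L40 – p. 128 L2); proof of Prop. D.4 (1) (p. 131 L27–34).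
* [KonnoKonno2007] K. Konno, T. Konno, Thm. 5.4.
-/

set_option autoImplicit false
set_option linter.dupNamespace false

noncomputable section

open NumberField NumberField.InfinitePlace MeasureTheory IsDedekindDomain Matrix
open scoped Matrix ComplexOrder

namespace Summit.HodgeConjecture.HodgeConjecture.Cruxes.HLiu418.F0LD1ArchSignRelative

open Literature.NumberTheory.Automorphic Literature.NumberTheory.Automorphic.UnitaryGroup
open Literature.NumberTheory.Automorphic.UnitaryCurveForms
open Literature.NumberTheory.Automorphic.IdeleClassGroup
open Literature.NumberTheory.Automorphic.Liu2021
open Literature.NumberTheory.GelbartRogawski1991 Literature.NumberTheory.GelbartRogawski1991.UnitaryDualPair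
open Literature.NumberTheory.Weil1964
open Summit.HodgeConjecture.HodgeConjecture.Cruxes.HLiu418.F0LD2ArchSignAt

set_option maxHeartbeats 1600000 in
/-- **[Liu2021, Lem. D.2 (3)], RELATIVE FORM AT THE PLACE OF `ι` (line LD1, step (L-Dι)).**  For the letter's field ∕ frame ∕ signature ∕ definiteness ∕ degree
data with `Im ι(t) = 0`, a cone frame `𝔣` of `H` at `cmPlace L ι`, the pinned transport `ιA`, and discrete `P`, `P′` of `U(H)`: if `P` meets the theta lift from
`⟨a′⟩` and `P′` the one from `⟨a″⟩` at the conjugate-symplectic `λ` along `ιA`, and both are holomorphic-cotangent at `cmPlace L ι` for `𝔣`, then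
`0 < Im e♮(a′·(2·imagUnit L)⁻¹) · Im e♮(a″·(2·imagUnit L)⁻¹)`, `e♮ = (cmPlace L ι).1.embedding` — the two lines have THE SAME archimedean sign at `ι`
(★ `re_mul_im_lt_zero_of_meets_of_hol₂` twice, for either sign of `Re ι(t)`). [cite: Liu2021, App. D Lem. D.2 (3) (p. 127 L40 – p. 128 L2); proof of Prop. D.4 (1) (p. 131 L27–34)]
[cite: KonnoKonno2007, Thm. 5.4] -/
theorem im_mul_im_pos_of_meets_of_hol₂ (L : Type) [Field L] [NumberField L] [IsCMField L] (ι : L →+* ℂ) (H : Matrix (Fin 2) (Fin 2) L)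
    (dV : Fin 2 → L) (hdV : ∀ i, IsCMField.complexConj L (dV i) = dV i) (hdV0 : ∀ i, dV i ≠ 0)
    (t : L) (ht : t ≠ 0) (hτt' : (ι t).im = 0) (g : GL (Fin 2) L)
    (hg : formCongr ((IsCMField.complexConj L : L ≃ₐ[↥(maximalRealSubfield L)] L) : L →+* L) g (t • H) = Matrix.diagonal dV)
    (hT : ∃ T : GL (Fin 2) ℂ, formCongr (starRingEnd ℂ) T ((Matrix.diagonal dV).map ι) = Matrix.diagonal ![(1 : ℂ), -1])
    (hpos : ∀ τ' : L →+* ℂ, InfinitePlace.mk τ' ≠ InfinitePlace.mk ι → ((Matrix.diagonal dV).map τ').PosDef)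
    (h4 : 4 ≤ Module.finrank ℚ L)
    (𝔣 : ConeFrame L H (cmPlace L ι))
    {μ : Measure (adelicGroupData (↥(maximalRealSubfield L)) L (IsCMField.complexConj L) 2 H).automorphicQuotient}
    [(adelicGroupData (↥(maximalRealSubfield L)) L (IsCMField.complexConj L) 2 H).IsAutomorphicMeasure μ]
    {n' : ℕ} (e₁ : Fin 2 × Fin 1 ≃ Fin n')
    (ιA : (adelicGroupData (↥(maximalRealSubfield L)) L (IsCMField.complexConj L) 2 H).Adelic →*
      ↥(UnitaryGroup.adelic (↥(maximalRealSubfield L)) L (IsCMField.complexConj L) 2 (Matrix.diagonal dV)))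
    (hιA : ∀ k, ((ιA k : ↥(UnitaryGroup.adelic (↥(maximalRealSubfield L)) L (IsCMField.complexConj L) 2 (Matrix.diagonal dV))) :
          GL (Fin 2) (AdeleRing (𝓞 L) L)) =
        (toAdeleGL L g)⁻¹ * adelicVal (↥(maximalRealSubfield L)) L (IsCMField.complexConj L) 2 H k * toAdeleGL L g)
    [CompactSpace (↥(UnitaryGroup.adelic (↥(maximalRealSubfield L)) L (IsCMField.complexConj L) 2 (Matrix.diagonal dV)) ⧸
        (UnitaryGroup.toAdelic (↥(maximalRealSubfield L)) L (IsCMField.complexConj L) 2 (Matrix.diagonal dV)).range)]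
    (P P' : DiscreteAutomorphicRep (adelicGroupData (↥(maximalRealSubfield L)) L (IsCMField.complexConj L) 2 H) μ)
    (lam : Literature.NumberTheory.Automorphic.IdeleClassGroup L →ₜ* Circle) (hlam : IsConjugateSymplectic L lam)
    (a' a'' : (↥(maximalRealSubfield L))ˣ)
    (hmeets : MeetsThetaLiftFromLine L 2 H e₁ dV hdV hdV0 P lam hlam a' ιA) (hmeets' : MeetsThetaLiftFromLine L 2 H e₁ dV hdV hdV0 P' lam hlam a'' ιA)
    (hhol : P.IsHolCotangentAt₂ (IsCMField.complexConj_ne_one L) (UnitaryGroup.complexConj_smul_infinitePlace L) (cmPlace L ι) 𝔣)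
    (hhol' : P'.IsHolCotangentAt₂ (IsCMField.complexConj_ne_one L) (UnitaryGroup.complexConj_smul_infinitePlace L) (cmPlace L ι) 𝔣) :
    0 < ((cmPlace L ι).1.embedding (algebraMap (↥(maximalRealSubfield L)) L a' * (2 * imagUnit L)⁻¹)).im *
      ((cmPlace L ι).1.embedding (algebraMap (↥(maximalRealSubfield L)) L a'' * (2 * imagUnit L)⁻¹)).im := by
  -- `[U(H)]` is compact: `diag dV` is definite at a place `τ ≠ ι`
  haveI : CompactSpace (adelicGroupData (↥(maximalRealSubfield L)) L (IsCMField.complexConj L) 2 H).automorphicQuotient := by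
    obtain ⟨τ, hτ⟩ := UnitaryGroup.exists_infinitePlace_ne L h4 ι
    exact UnitaryGroup.compactSpace_adelicGroupData_automorphicQuotient L 2 H
      (UnitaryGroup.anisotropic_of_formCongr_smul_eq_of_posDef L 2 H dV t ht g hg τ (hpos τ hτ))
  -- the real place of `L⁺` below `ι`
  let v₀ : {v : InfinitePlace (↥(maximalRealSubfield L)) // v.IsReal} :=
    ⟨(InfinitePlace.mk ι).comap (algebraMap (↥(maximalRealSubfield L)) L),
      Literature.NumberTheory.GelbartRogawski1991.UnitaryDualPair.ArchSplitting.QuadExt.isReal_comap_of_smul_eq (F := ↥(maximalRealSubfield L))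
        (E := L) (c := IsCMField.complexConj L) (w := ⟨InfinitePlace.mk ι, IsTotallyComplex.isComplex _⟩) (UnitaryGroup.complexConj_smul_infinitePlace L _)
        (IsCMField.complexConj_ne_one L)⟩
  have hw₀ : (cmPlaceOver L v₀).1 = InfinitePlace.mk ι := comap_injective_of_isCMField (L := L) (cmPlaceOver_comap L v₀)
  have hv₀ : cmPlace L ι = cmPlaceOver L v₀ := (Subtype.ext hw₀).symm
  -- `e♮(t) = ι(t)` is a non-zero real, `e♮(dV p) = ι(dV p)` is real
  obtain ⟨tr, htr⟩ : ∃ tr : ℝ, ι t = (tr : ℂ) := ⟨(ι t).re, Complex.ext (by simp) (by simp [hτt'])⟩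
  have htr0 : tr ≠ 0 := fun h0 => (map_ne_zero ι).2 ht (by rw [htr, h0, Complex.ofReal_zero])
  have het : (cmPlace L ι).1.embedding t = (tr : ℂ) := by rw [embedding_cmPlace_apply_of_im_eq_zero L ι t hτt', htr]
  have hdVim : ∀ p, (ι (dV p)).im = 0 := fun p => by
    have h1 : ι (cmConjRingHom L (dV p)) = starRingEnd ℂ (ι (dV p)) := embedding_cmConjRingHom L ι (dV p)
    have h2 : cmConjRingHom L (dV p) = dV p := hdV p
    rw [h2] at h1
    exact Complex.conj_eq_iff_im.1 h1.symm
  have hedV : ∀ p, (cmPlace L ι).1.embedding (dV p) = (((ι (dV p)).re : ℝ) : ℂ) := fun p => by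
    rw [embedding_cmPlace_apply_of_im_eq_zero L ι (dV p) (hdVim p)]
    exact Complex.ext (by simp) (by simp [hdVim p])
  have hre : ∀ p, ((cmPlace L ι).1.embedding (dV p) * ((cmPlace L ι).1.embedding t)⁻¹).re = (ι (dV p)).re * tr⁻¹ := fun p => by
    rw [hedV, het, ← Complex.ofReal_inv, ← Complex.ofReal_mul, Complex.ofReal_re]
  have hσt : ((cmPlace L ι).1.embedding t).im = 0 := by rw [het, Complex.ofReal_im]
  -- the signature gives a negative and a positive `ι(dV p)`; the frame signs for EITHER sign of `tr`
  obtain ⟨T, hT'⟩ := hT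
  rw [Matrix.diagonal_map (map_zero ι)] at hT'
  obtain ⟨qm, qp, hne, hqm, hqp⟩ := exists_neg_pos_of_sig₂ (fun p => ι (dV p)) T hT'
  obtain ⟨pm, pp, hne', hm, hp⟩ : ∃ pm pp : Fin 2, pp ≠ pm ∧
      ((cmPlace L ι).1.embedding (dV pm) * ((cmPlace L ι).1.embedding t)⁻¹).re < 0 ∧
      0 < ((cmPlace L ι).1.embedding (dV pp) * ((cmPlace L ι).1.embedding t)⁻¹).re := by
    rcases lt_or_gt_of_ne htr0 with htr_neg | htr_pos
    · refine ⟨qp, qm, hne.symm, ?_, ?_⟩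
      · rw [hre]; exact mul_neg_of_pos_of_neg hqp (inv_lt_zero.2 htr_neg)
      · rw [hre]; exact mul_pos_of_neg_of_neg hqm (inv_lt_zero.2 htr_neg)
    · refine ⟨qm, qp, hne, ?_, ?_⟩
      · rw [hre]; exact mul_neg_of_neg_of_pos hqm (inv_pos.2 htr_pos)
      · rw [hre]; exact mul_pos hqp (inv_pos.2 htr_pos)
  -- the two-sided theorem, twice
  have k1 := re_mul_im_lt_zero_of_meets_of_hol₂ L H dV hdV hdV0 t ht g hg v₀ (cmPlace L ι) hv₀ hσt pm pp hne' hm hp 𝔣 e₁ ιA hιA P lam hlam a'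
    hmeets hhol
  have k2 := re_mul_im_lt_zero_of_meets_of_hol₂ L H dV hdV hdV0 t ht g hg v₀ (cmPlace L ι) hv₀ hσt pm pp hne' hm hp 𝔣 e₁ ιA hιA P' lam hlam a''
    hmeets' hhol'
  have k3 := mul_pos_of_neg_of_neg k1 k2
  rw [het, Complex.ofReal_re] at k3
  have htr2 : 0 < tr * tr := mul_self_pos.2 htr0
  nlinarith [k3, htr2]

end Summit.HodgeConjecture.HodgeConjecture.Cruxes.HLiu418.F0LD1ArchSignRelative

end
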